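import Summits.QuantumFields.YangMills.Theorems.SwapVirialDeficitSectorLaplaceTipGlueRates
import Summits.QuantumFields.YangMills.Theorems.SwapVirialDeficitSectorLaplaceTipGlueFacts
import Summits.QuantumFields.YangMills.Theorems.SwapVirialDeficitSectorLaplaceTipGlueTransfer
import Summits.QuantumFields.YangMills.Theorems.SwapVirialDeficitSectorLaplaceTipMidConcrete
import Summits.QuantumFields.YangMills.Theorems.SwapVirialDeficitSectorLaplaceTipCoreProfileConcrete
import Summits.QuantumFields.YangMills.Theorems.SwapVirialDeficitSectorLaplaceTipMidDischarge
import Summits.QuantumFields.YangMills.Theorems.SwapVirialDeficitSectorLaplaceTipPos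
import Summits.QuantumFields.YangMills.Theorems.SwapVirialDeficitSectorLaplaceBulkMassFloor
import HarnessLib

/-!
# THE TIP OF SKELETON ➎, THE GLUE: `stub_core_tip` from ONE typed socket (hCore) — the core ceiling of the hub integral with the profile inside
# (cell ym-idea-1; free-hands support of ⟨stmt-QuantumFields-24197⟩ `SwapVirialDeficit.SwapGluedStiffness`; LEAD g100 ruling B1: frozen binder)

`halfBound_pos_of_core (hCore) : <hpos socket of ✓stub_core_tip_of_pos>` and `stub_core_tip_of_core (hCore) : <stub_core_tip VERBATIM>`, where (hCore) is the
producers' frozen binder (LEAD g100, 2026-09-01T01:36Z): `∃ Φ>0 cΦ CT pT QT>0 K₁>0 k₁ DR≥1 dR, ∀ L b (K₁L^{k₁} ≤ b) ε (GoodSign ε) δs δt (DR·L^{dR} ≤ δs ≤ δt),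
hubIntegral (hubAt δt 1) ε b ≤ Φ·L^{cΦ}·((2π/b)^{α_L}·∫ p, Profile(δt,p)·𝔪(hubAt δs 1) ε p) + exp(CT·L^{pT} − b/(QT·L^{pT}))`.

The glue, per `(L, τ, b, ε)` with law scale `q = b^{1/(2(k+1))}` (`K, k` of ✓`tipMid_window_le`), `ψ = q⁻¹`, core cut `δ_b = √(q−1)`, tip cut `δ_τ = √(τ⁻¹−1)`,
corner radius `ρ₀ = ρO(L)/4`, reference shell `[δr(L), 2δr(L)]`, transfer letter `S̄ = (DR + 2A)·L^{dR+18} ≤ δ_b`: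
positive half-window `W = Mid ⊔ Core` (`Mid = W ∩ {δ ≤ δ_b}`, `Core ⊆ Ioi δ_b`); MID by the law ✓`tipMid_window_le` (Box = `{ρ₀² ≤ |p|²}`, Boxᶜ = disc) +
✓`tipMidBox_le_mbMain` + ✓`tipCorner_le_mbMain` + ✓`tipMid_coef_le` ∕ ✓`tipCorner_coef_le` + ✓`tipMid_algebra`; CORE by ✓`tipCore_le_mbMain_of_profile` fed with (hCore)
at `δs := S̄` transferred to the shell by ✓`coreProfile_transfer` (✓`mbDensity_hubAt_comparable_profile`, `p' = p`) + ✓`tipCore_coef_le`; rates `τ^{3/8}` and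
`δ_b^{-3/4} ≤ 2b^{-3/(16(k+1))}` (✓`deltaB_facts`, ✓`q_rpow_neg_eq`); tails by ✓`tipTails_le` (✓`totalMass_le_exp`, ✓`lawTail_exponent`).

HONEST LABEL: this closes `stub_core_tip` MODULO (hCore) only; (hCore) = `hubIntegral_hubAt_core_ceiling` is the producers' multi-seat analytic socket (OPEN at filing);
⟨24197⟩ ∕ ⟨24194⟩ OPEN; item of record ⟨24085⟩ aside ∕ untouched; the Yang–Mills mass gap is NOT proved; no summit is proved by a line.
THEOREMS ONLY (0 `def`, 0 `sorry`), standard axioms, no instances.  Seat ym-line-fcl-p3 g49, `--supports stmt-QuantumFields-24197`.  References: [cite: Luscher1983, §2]; [folklore].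
-/

set_option autoImplicit false
set_option synthInstance.maxSize 1024

noncomputable section

open MeasureTheory Quaternion Set Module
open scoped Quaternion BigOperators ENNReal
open Literature.MathematicalPhysics.QuantumLattice
open Literature.MathematicalPhysics.QuantumFieldTheory hiding SU2
open Summit.QuantumFields.YangMills.Theorems.SwapTwistDeficit.ToronLog

namespace Summit.QuantumFields.YangMills.Theorems.SwapVirialDeficit.SectorLaplace

open Summit.QuantumFields.YangMills.Theorems.FemtoTransferGap
open Summit.QuantumFields.YangMills.Theorems.FemtoTransferGap.TT
open Summit.QuantumFields.YangMills.Theorems.VirialFluxGap.RingDeficit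
open Summit.QuantumFields.YangMills.Theorems.SwapVirialDeficit.SwapRing
open Summit.QuantumFields.YangMills.Theorems.SwapVirialDeficit.BlowUpRing

variable {L : ℕ} [NeZero L]

set_option maxHeartbeats 4000000 in
/-- ★★ **THE GLUE**: the frozen (hCore) binder ⟹ the hpos socket of ✓`stub_core_tip_of_pos` (positive half-window bound in the two-rate + tail form). [cite: Luscher1983, §2] -/
theorem halfBound_pos_of_core
    (hCore : ∃ Φ : ℝ, 0 < Φ ∧ ∃ cΦ : ℕ, ∃ CT : ℝ, ∃ pT : ℕ, ∃ QT : ℝ, 0 < QT ∧ ∃ K₁ : ℝ, 0 < K₁ ∧ ∃ k₁ : ℕ, ∃ DR : ℝ, 1 ≤ DR ∧ ∃ dR : ℕ,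
      ∀ (L : ℕ) [NeZero L] (b : ℝ), K₁ * (L : ℝ) ^ k₁ ≤ b → ∀ ε : GnoSign L, GoodSign ε → ∀ δs δt : ℝ, DR * (L : ℝ) ^ dR ≤ δs → δs ≤ δt →
        hubIntegral (L := L) (hubAt δt 1) ε b ≤
          Φ * (L : ℝ) ^ cΦ * ((2 * Real.pi / b) ^ alpha L * ∫ p : ℝ × ℝ, ((1 + δt ^ 2) ^ 2 / (1 + (p.1 ^ 2 / (1 + p.1 ^ 2) + p.2 ^ 2 / (1 + p.2 ^ 2)) * (1 + δt ^ 2))) *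
            mbDensity (L := L) (hubAt δs 1) ε p) + Real.exp (CT * (L : ℝ) ^ pT - b / (QT * (L : ℝ) ^ pT))) :
    ∃ C : ℝ, 0 < C ∧ ∃ c : ℕ, ∃ γ : ℝ, 0 < γ ∧ ∃ D : ℝ, 0 ≤ D ∧ ∃ d d' : ℕ, ∃ η : ℝ, 0 < η ∧
      ∃ CT : ℝ, ∃ pT : ℕ, ∃ QT : ℝ, 0 < QT ∧ ∃ qT : ℕ, ∃ K₁ : ℝ, 0 < K₁ ∧ ∃ k₁ : ℕ, ∃ τw : ℝ, 0 < τw ∧ ∃ kw : ℕ,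
      ∀ (L : ℕ) [NeZero L] (τ : ℝ), 0 < τ → τ ≤ τw / (L : ℝ) ^ kw → ∀ b : ℝ, K₁ * (L : ℝ) ^ k₁ * τ⁻¹ ^ k₁ ≤ b → ∀ ε : GnoSign L, GoodSign ε →
        stiffKappa L (1 / 8) * (coneConst * Real.pi *
          ∫ δ in {δ : ℝ | (1 + δ ^ 2)⁻¹ < τ ∧ 0 < δ}, ((1 + δ ^ 2)⁻¹) ^ 2 * hubIntegral (L := L) (hubAt δ 1) ε b) ≤
          (C * (L : ℝ) ^ c * τ ^ γ + D * (L : ℝ) ^ d * τ⁻¹ ^ d' * b ^ (-η)) *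
              ((2 * Real.pi / b) ^ alpha L * ∫ a in HubBulk τ, (∫ p : ℝ × ℝ, mbDensity (L := L) a ε p) ∂coneMeasure) +
            Real.exp (CT * (L : ℝ) ^ pT - Real.sqrt b * τ ^ qT / (QT * (L : ℝ) ^ pT)) := by
  obtain ⟨Φ, hΦ, cΦ, CT, pT, QT, hQT, K₁, hK₁, k₁, DR, hDR, dR, hcore⟩ := hCore
  obtain ⟨K, hK, k, hlaw⟩ := tipMid_window_le
  have hn : (2 * (k + 1) : ℕ) ≠ 0 := by omega
  have hs2 : 0 < Real.sqrt 2 := Real.sqrt_pos.2 (by norm_num)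
  refine ⟨9 * 2 * ((3 * (19 * 20400) ^ 4 * 7200 ^ 2 * (2 * 1800 ^ 2) * (16 * (12 * 44712000 * 2304 * 36) ^ 2 * 2) * Real.sqrt 2 *
          ((96 / 7) * (12 * 122689728 * 2304 * 36) ^ 3)) +
        (256 * 2 * 16 * (4 / 3) * 25 * 4 * 2 * (20 / 3) * 2 * (12 * 122689728 * 2304 * 36) * (3 * (19 * 20400) ^ 4 * 7200 ^ 2 * (2 * 1800 ^ 2)) ^ 2 *
          (12 * 122689728 * 2304 * 36) ^ 4 * (12 * 44712000 * 2304 * 36) ^ 2 * (12 * 122689728 * 2304 * 36) ^ 2)), by positivity,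
    278, 3 / 8, by norm_num,
    9 * (Φ * ((3 * (19 * 20400) ^ 4 * 7200 ^ 2 * (2 * 1800 ^ 2)) * (4 * (DR + 2 * (12 * 122689728 * 2304 * 36)) ^ 4)) *
      ((96 / 7) * (12 * 122689728 * 2304 * 36) ^ 3 *
        (32 * (12 * 44712000 * 2304 * 36) ^ 2 + 1024 * (3 * (19 * 20400) ^ 4 * 7200 ^ 2 * (2 * 1800 ^ 2)) * (25 * (12 * 122689728 * 2304 * 36) ^ 4) * 4 *
          (8 * (12 * 44712000 * 2304 * 36) ^ 2) * (2 * (4 / 3)))) * 2), by positivity,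
    4 + (cΦ + (56 + 4 * (dR + 18))) + 218, 0, 3 / (8 * ((2 * (k + 1) : ℕ) : ℝ)), by positivity,
    28 + coneConst * Real.pi + |Real.log (coneConst ^ 3 / 64)| + |CT|, k * k + pT + 4, K ^ k + QT, by positivity, 0,
    4 ^ (k + 1) + 2 ^ (2 * (k + 1)) * (DR + 2 * (12 * 122689728 * 2304 * 36)) ^ (2 * (2 * (k + 1))) + K ^ (2 * (k + 1)) + K₁, by positivity,
    k * (2 * (k + 1)) + (dR + 18) * (2 * (2 * (k + 1))) + k₁, (17 * (12 * 122689728 * 2304 * 36 : ℝ) ^ 2)⁻¹, by positivity, 36, ?_⟩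
  intro L _ τ hτ hτle b hb ε hε
  -- §0 numerology of `L`, `τ`
  obtain ⟨hL1, -, -, -, -⟩ := cell_sizes (L := L)
  obtain ⟨hδr1, hρO0, hρO1, -, -⟩ := cornerWindow_facts (L := L)
  obtain ⟨hδrle, -⟩ := tipDeltaR_facts (L := L)
  have hR0 := tipR0_le (L := L)
  have hcc : 0 < coneConst * Real.pi := mul_pos coneConst_pos Real.pi_pos
  have hL4 : (1 : ℝ) ≤ (L : ℝ) ^ 4 := one_le_pow₀ hL1
  have hκ : 0 < stiffKappa L (1 / 8) ∧ stiffKappa L (1 / 8) ≤ 9 * (L : ℝ) ^ 4 := by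
    unfold stiffKappa; constructor <;> linarith
  -- the window `τ ≤ (17A²L³⁶)⁻¹ ≤ (1+16δr²)⁻¹ ≤ ½`
  have hτw' : τ ≤ (1 + 16 * (12 * 122689728 * 2304 * (Fintype.card (Fol L) : ℝ) ^ 2 * (L : ℝ) ^ 10) ^ 2)⁻¹ := by
    have h2 : (17 * (12 * 122689728 * 2304 * 36 : ℝ) ^ 2)⁻¹ / (L : ℝ) ^ 36 = (17 * (12 * 122689728 * 2304 * 36 : ℝ) ^ 2 * (L : ℝ) ^ 36)⁻¹ := by
      rw [div_eq_mul_inv, ← mul_inv]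
    have h3 : 1 + 16 * (12 * 122689728 * 2304 * (Fintype.card (Fol L) : ℝ) ^ 2 * (L : ℝ) ^ 10) ^ 2 ≤ 17 * (12 * 122689728 * 2304 * 36 : ℝ) ^ 2 * (L : ℝ) ^ 36 := by
      have h4 : (12 * 122689728 * 2304 * (Fintype.card (Fol L) : ℝ) ^ 2 * (L : ℝ) ^ 10) ^ 2 ≤ (12 * 122689728 * 2304 * 36 * (L : ℝ) ^ 18) ^ 2 :=
        pow_le_pow_left₀ (by positivity) hδrle 2
      have h5 : (1 : ℝ) ≤ (12 * 122689728 * 2304 * 36 : ℝ) ^ 2 * (L : ℝ) ^ 36 := one_le_mul_of_one_le_of_one_le (by norm_num) (one_le_pow₀ hL1)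
      nlinarith only [h4, h5]
    rw [h2] at hτle
    exact hτle.trans (inv_anti₀ (by positivity) h3)
  have hτ2 : τ ≤ 1 / 2 := by
    have h16 : (16 : ℝ) ≤ 16 * (12 * 122689728 * 2304 * (Fintype.card (Fol L) : ℝ) ^ 2 * (L : ℝ) ^ 10) ^ 2 := by nlinarith only [hδr1]
    have : (1 + 16 * (12 * 122689728 * 2304 * (Fintype.card (Fol L) : ℝ) ^ 2 * (L : ℝ) ^ 10) ^ 2)⁻¹ ≤ (2 : ℝ)⁻¹ := inv_anti₀ (by norm_num) (by linarith only [h16])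
    linarith only [hτw'.trans this]
  have hτ1 : τ ≤ 1 := by linarith only [hτ2]
  obtain ⟨hδτ1, -, -⟩ := tipDeltaTau_facts hτ hτ2
  have hδτ0 : 0 < Real.sqrt (τ⁻¹ - 1) := by linarith only [hδτ1]
  have hτ38 : 0 ≤ τ ^ (3 / 8 : ℝ) := Real.rpow_nonneg hτ.le _
  -- §1 thresholds in `b`
  have hτinv1 : 1 ≤ τ⁻¹ := (one_le_inv₀ hτ).2 hτ1
  have hKtot0 : 0 ≤ 4 ^ (k + 1) + 2 ^ (2 * (k + 1)) * (DR + 2 * (12 * 122689728 * 2304 * 36)) ^ (2 * (2 * (k + 1))) + K ^ (2 * (k + 1)) + K₁ := by positivity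
  have hKL : (4 ^ (k + 1) + 2 ^ (2 * (k + 1)) * (DR + 2 * (12 * 122689728 * 2304 * 36)) ^ (2 * (2 * (k + 1))) + K ^ (2 * (k + 1)) + K₁) *
      (L : ℝ) ^ (k * (2 * (k + 1)) + (dR + 18) * (2 * (2 * (k + 1))) + k₁) ≤ b := by
    have h1 : (1 : ℝ) ≤ τ⁻¹ ^ (k * (2 * (k + 1)) + (dR + 18) * (2 * (2 * (k + 1))) + k₁) := one_le_pow₀ hτinv1
    exact (le_mul_of_one_le_right (by positivity) h1).trans hb
  have hLk : ∀ m : ℕ, m ≤ k * (2 * (k + 1)) + (dR + 18) * (2 * (2 * (k + 1))) + k₁ → ∀ X : ℝ, 0 ≤ X →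
      X ≤ 4 ^ (k + 1) + 2 ^ (2 * (k + 1)) * (DR + 2 * (12 * 122689728 * 2304 * 36)) ^ (2 * (2 * (k + 1))) + K ^ (2 * (k + 1)) + K₁ → X * (L : ℝ) ^ m ≤ b :=
    fun m hm X hX0 hX => (mul_le_mul hX (pow_le_pow_right₀ hL1 hm) (by positivity) hKtot0).trans hKL
  have hp4 : (0 : ℝ) ≤ 4 ^ (k + 1) := by positivity
  have hpS : (0 : ℝ) ≤ 2 ^ (2 * (k + 1)) * (DR + 2 * (12 * 122689728 * 2304 * 36)) ^ (2 * (2 * (k + 1))) := by positivity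
  have hpK : (0 : ℝ) ≤ K ^ (2 * (k + 1)) := by positivity
  have h4b : (4 : ℝ) ^ (k + 1) ≤ b := by
    have := hLk 0 (Nat.zero_le _) (4 ^ (k + 1)) hp4 (by linarith only [hpS, hpK, hK₁])
    simpa using this
  have hK1b : K₁ * (L : ℝ) ^ k₁ ≤ b := hLk k₁ (Nat.le_add_left _ _) K₁ hK₁.le (by linarith only [hp4, hpS, hpK])
  -- §2 the law scale `q`, `ψ = q⁻¹`, the core cut `δ_b = √(q-1)` and the transfer letter `S̄`
  obtain ⟨hb0, hb1, hq2, hqn, hsqrt, hroot⟩ := lawScale_facts k h4b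
  have hqη := q_rpow_neg_eq hb0.le (2 * (k + 1)) hn
  set q : ℝ := b ^ (((2 * (k + 1) : ℕ) : ℝ)⁻¹) with hq
  have hq0 : 0 < q := by linarith only [hq2]
  have hq1 : 1 ≤ q := by linarith only [hq2]
  obtain ⟨hδb1, hψ0, hψ1, hδb34, hwinψ, hSle⟩ := deltaB_facts hq2
  have hXq : K * (L : ℝ) ^ k ≤ q := by
    refine hroot _ (by positivity) ?_
    have h := hLk (k * (2 * (k + 1))) ((Nat.le_add_right _ _).trans (Nat.le_add_right _ _)) (K ^ (2 * (k + 1))) hpK (by linarith only [hp4, hpS, hK₁])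
    calc (K * (L : ℝ) ^ k) ^ (2 * (k + 1)) = K ^ (2 * (k + 1)) * (L : ℝ) ^ (k * (2 * (k + 1))) := by rw [mul_pow, ← pow_mul]
      _ ≤ b := h
  obtain ⟨S, hSdef⟩ : ∃ S : ℝ, S = (DR + 2 * (12 * 122689728 * 2304 * 36)) * (L : ℝ) ^ (dR + 18) := ⟨_, rfl⟩
  have hS1 : 1 ≤ S := by
    rw [hSdef]; exact one_le_mul_of_one_le_of_one_le (by linarith only [hDR]) (one_le_pow₀ hL1)
  have hS0 : 0 ≤ S := by linarith only [hS1]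
  have hSq : 1 + S ^ 2 ≤ q := by
    refine hroot _ (by positivity) ?_
    have h1 : 1 + S ^ 2 ≤ 2 * S ^ 2 := by nlinarith only [hS1]
    have h2 : (1 + S ^ 2) ^ (2 * (k + 1)) ≤ (2 * S ^ 2) ^ (2 * (k + 1)) := pow_le_pow_left₀ (by positivity) h1 _
    have h3 : (2 * S ^ 2) ^ (2 * (k + 1)) = 2 ^ (2 * (k + 1)) * (DR + 2 * (12 * 122689728 * 2304 * 36)) ^ (2 * (2 * (k + 1))) * (L : ℝ) ^ ((dR + 18) * (2 * (2 * (k + 1)))) := by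
      rw [hSdef, mul_pow, ← pow_mul, mul_pow, ← pow_mul]; ring
    have h4 := hLk ((dR + 18) * (2 * (2 * (k + 1)))) ((Nat.le_add_left _ _).trans (Nat.le_add_right _ _)) _ hpS (by linarith only [hp4, hpK, hK₁])
    rw [← h3] at h4
    exact h2.trans h4
  have hSδ : S ≤ Real.sqrt (q - 1) := hSle S hS0 hSq
  have hS2 : 2 * (12 * 122689728 * 2304 * (Fintype.card (Fol L) : ℝ) ^ 2 * (L : ℝ) ^ 10) ≤ S := by
    rw [hSdef]
    have h1 : 2 * (12 * 122689728 * 2304 * (Fintype.card (Fol L) : ℝ) ^ 2 * (L : ℝ) ^ 10) ≤ (2 * (12 * 122689728 * 2304 * 36)) * (L : ℝ) ^ 18 := by linarith only [hδrle]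
    refine h1.trans (mul_le_mul (by linarith only [hDR]) (pow_le_pow_right₀ hL1 (by omega)) (by positivity) (by positivity))
  have hDRS : DR * (L : ℝ) ^ dR ≤ S := by
    rw [hSdef]; exact mul_le_mul (by norm_num) (pow_le_pow_right₀ hL1 (by omega)) (by positivity) (by positivity)
  -- §3 the sets: `W = Mid ⊔ Core`
  have hWm := (tipWindow_halves_measurable_disjoint τ).1
  set W : Set ℝ := {δ : ℝ | (1 + δ ^ 2)⁻¹ < τ ∧ 0 < δ} with hWdef
  have hWsub : W ⊆ Ioi (Real.sqrt (τ⁻¹ - 1)) := by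
    intro δ hδ
    obtain ⟨h1, h2⟩ := hδ
    have h3 : τ⁻¹ < 1 + δ ^ 2 := by rwa [inv_lt_comm₀ (by positivity) hτ] at h1
    show Real.sqrt (τ⁻¹ - 1) < δ
    calc Real.sqrt (τ⁻¹ - 1) < Real.sqrt (δ ^ 2) := Real.sqrt_lt_sqrt (by linarith only [hτinv1]) (by linarith only [h3])
      _ = δ := Real.sqrt_sq h2.le
  have hW1 : ∀ δ ∈ W, 1 ≤ δ := fun δ hδ => hδτ1.trans (le_of_lt (hWsub hδ))
  set Mid : Set ℝ := W ∩ Iic (Real.sqrt (q - 1)) with hMiddef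
  set Core : Set ℝ := W \ Iic (Real.sqrt (q - 1)) with hCoredef
  have hMidm : MeasurableSet Mid := hWm.inter measurableSet_Iic
  have hMid₁ : Mid ⊆ Ioi (Real.sqrt (τ⁻¹ - 1)) := fun δ hδ => hWsub hδ.1
  have hMidwin : Mid ⊆ {δ : ℝ | q⁻¹ ≤ 4 * δ ^ 2 / (1 + δ ^ 2) ^ 2 ∧ q⁻¹ ≤ (1 + δ ^ 2)⁻¹} :=
    fun δ hδ => hwinψ δ (hW1 δ hδ.1) (Set.mem_Iic.1 hδ.2)
  have hCoresub : Core ⊆ Ioi (Real.sqrt (q - 1)) := fun δ hδ => Set.mem_Ioi.2 (lt_of_not_ge fun h => hδ.2 (Set.mem_Iic.2 h))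
  have hfint := integrable_sqInv_mul_hubIntegral_hubAt (L := L) ε hb0.le
  have hf0 : ∀ δ : ℝ, 0 ≤ ((1 + δ ^ 2)⁻¹) ^ 2 * hubIntegral (L := L) (hubAt δ 1) ε b :=
    fun δ => mul_nonneg (by positivity) (hubIntegral_nonneg _ _ _)
  have hsplit : ∫ δ in W, ((1 + δ ^ 2)⁻¹) ^ 2 * hubIntegral (L := L) (hubAt δ 1) ε b =
      (∫ δ in Mid, ((1 + δ ^ 2)⁻¹) ^ 2 * hubIntegral (L := L) (hubAt δ 1) ε b) + ∫ δ in Core, ((1 + δ ^ 2)⁻¹) ^ 2 * hubIntegral (L := L) (hubAt δ 1) ε b :=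
    (integral_inter_add_sdiff measurableSet_Iic hfint.integrableOn).symm
  have hcore_mono : ∫ δ in Core, ((1 + δ ^ 2)⁻¹) ^ 2 * hubIntegral (L := L) (hubAt δ 1) ε b ≤
      ∫ δ in Ioi (Real.sqrt (q - 1)), ((1 + δ ^ 2)⁻¹) ^ 2 * hubIntegral (L := L) (hubAt δ 1) ε b :=
    setIntegral_mono_set hfint.integrableOn (Filter.Eventually.of_forall hf0) hCoresub.eventuallyLE
  -- §4 MID
  have hM0 : 0 ≤ ∫ a in HubBulk τ, (∫ p : ℝ × ℝ, mbDensity (L := L) a ε p) ∂coneMeasure :=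
    integral_nonneg fun a => integral_nonneg fun p => mbDensity_nonneg _ _ _
  have hG0 : 0 ≤ (2 * Real.pi / b) ^ alpha L := Real.rpow_nonneg (by positivity) _
  have hρ4 : 0 < (12 * (Fintype.card (Fol L) : ℝ) * 44712000 * (L : ℝ) ^ 4 * (2304 * (L : ℝ) ^ 6 * (Fintype.card (Fol L) : ℝ)))⁻¹ / 4 := by positivity
  have hρ41 : (12 * (Fintype.card (Fol L) : ℝ) * 44712000 * (L : ℝ) ^ 4 * (2304 * (L : ℝ) ^ 6 * (Fintype.card (Fol L) : ℝ)))⁻¹ / 4 ≤ 1 := by linarith only [hρO1, hρO0]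
  set Box : Set (ℝ × ℝ) := {p : ℝ × ℝ | ((12 * (Fintype.card (Fol L) : ℝ) * 44712000 * (L : ℝ) ^ 4 * (2304 * (L : ℝ) ^ 6 * (Fintype.card (Fol L) : ℝ)))⁻¹ / 4) ^ 2 ≤
    p.1 ^ 2 + p.2 ^ 2} with hBoxdef
  set Dsc : Set (ℝ × ℝ) := {p : ℝ × ℝ | p.1 ^ 2 + p.2 ^ 2 <
    ((12 * (Fintype.card (Fol L) : ℝ) * 44712000 * (L : ℝ) ^ 4 * (2304 * (L : ℝ) ^ 6 * (Fintype.card (Fol L) : ℝ)))⁻¹ / 4) ^ 2} with hDscdef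
  have hBoxm : MeasurableSet Box := measurableSet_le measurable_const (by fun_prop)
  have hDscm : MeasurableSet Dsc := measurableSet_lt (by fun_prop) measurable_const
  have hcompl : Boxᶜ = Dsc := by
    ext p; simp only [hBoxdef, hDscdef, Set.mem_compl_iff, Set.mem_setOf_eq, not_le]
  have hthr : (K * (L : ℝ) ^ k * (1 / q⁻¹) ^ k) ^ 2 ≤ b := (lawThreshold_of_root k (by positivity) hXq).trans hqn.le
  have hlaw' := hlaw L q⁻¹ b hψ0 hψ1 hthr ε hε Mid hMidm hMidwin Box hBoxm
  rw [hcompl] at hlaw'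
  obtain ⟨cB, hcB⟩ : ∃ x : ℝ, x = (3 * (19 * 20400) ^ 4 * 7200 ^ 2 * (2 * 1800 ^ 2) * (16 * (12 * 44712000 * 2304 * 36) ^ 2 * 2) * Real.sqrt 2 *
      ((96 / 7) * (12 * 122689728 * 2304 * 36) ^ 3)) * (L : ℝ) ^ 146 * τ ^ (3 / 8 : ℝ) := ⟨_, rfl⟩
  obtain ⟨cD, hcD⟩ : ∃ x : ℝ, x = (256 * 2 * 16 * (4 / 3) * 25 * 4 * 2 * (20 / 3) * 2 * (12 * 122689728 * 2304 * 36) * (3 * (19 * 20400) ^ 4 * 7200 ^ 2 * (2 * 1800 ^ 2)) ^ 2 *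
      (12 * 122689728 * 2304 * 36) ^ 4 * (12 * 44712000 * 2304 * 36) ^ 2 * (12 * 122689728 * 2304 * 36) ^ 2) * (L : ℝ) ^ 274 * τ ^ (3 / 8 : ℝ) := ⟨_, rfl⟩
  have hboxC := (tipMidBox_le_mbMain (L := L) hε hτ hτw' hρ4 hMidm hMid₁).trans (mul_le_mul_of_nonneg_right (tipMid_coef_le (L := L) hτ hτ2) hM0)
  have hdiscC := (tipCorner_le_mbMain (L := L) hε hτ hτw' hρ4 hρ41 le_rfl hMidm hMid₁).trans
    (mul_le_mul_of_nonneg_right (tipCorner_coef_le (L := L) hτ hτ2) hM0)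
  rw [← hcB] at hboxC
  rw [← hcD] at hdiscC
  have hbhalf : b ^ (-(1 / 2 : ℝ)) = (q ^ (k + 1))⁻¹ := by
    rw [Real.rpow_neg hb0.le, ← Real.sqrt_eq_rpow, hsqrt]
  have hE : K * (L : ℝ) ^ k * (1 / q⁻¹) ^ k * b ^ (-(1 / 2 : ℝ)) ≤ 1 := by
    rw [hbhalf]; exact lawError_le_one k hXq hq0
  have hI1 : ∫ δ in Mid, ((1 + δ ^ 2)⁻¹) ^ 2 ≤ 1 := by
    have hg : IntegrableOn (fun δ : ℝ => (1 + δ ^ 2)⁻¹) Mid := integrable_inv_one_add_sq.integrableOn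
    have hle : ∀ δ : ℝ, ((1 + δ ^ 2)⁻¹) ^ 2 ≤ (1 + δ ^ 2)⁻¹ := fun δ =>
      pow_le_of_le_one (by positivity) (inv_le_one_of_one_le₀ (by nlinarith only [sq_nonneg δ])) two_ne_zero
    have hf : IntegrableOn (fun δ : ℝ => ((1 + δ ^ 2)⁻¹) ^ 2) Mid := by
      refine hg.mono' (by fun_prop : Measurable fun δ : ℝ => ((1 + δ ^ 2)⁻¹) ^ 2).aestronglyMeasurable
        (Filter.Eventually.of_forall fun δ => ?_)
      rw [Real.norm_eq_abs, abs_of_nonneg (by positivity)]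
      exact hle δ
    have h1 : ∫ δ in Mid, ((1 + δ ^ 2)⁻¹) ^ 2 ≤ ∫ δ in Mid, (1 + δ ^ 2)⁻¹ := setIntegral_mono_on hf hg hMidm fun δ _ => hle δ
    exact h1.trans ((setIntegral_inv_one_add_sq_le_inv hδτ0 hMid₁).trans (inv_le_one_of_one_le₀ hδτ1))
  have hMass0 : 0 ≤ ∫ η : GnoCoord L, gnoDensity η := integral_nonneg fun η => (gnoDensity_pos η).le
  have hXb0 : 0 ≤ ∫ δ in Mid, ((1 + δ ^ 2)⁻¹) ^ 2 * ∫ p in Box, mbDensity (L := L) (hubAt δ 1) ε p :=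
    setIntegral_nonneg hMidm fun δ _ => mul_nonneg (by positivity) (setIntegral_nonneg hBoxm fun p _ => mbDensity_nonneg _ _ _)
  have hXd0 : 0 ≤ ∫ δ in Mid, ((1 + δ ^ 2)⁻¹) ^ 2 * ∫ p in Dsc, mbDensity (L := L) (hubAt δ 1) ε p :=
    setIntegral_nonneg hMidm fun δ _ => mul_nonneg (by positivity) (setIntegral_nonneg hDscm fun p _ => mbDensity_nonneg _ _ _)
  have hmid := tipMid_algebra hcc hE hG0 hMass0 hI1 hXb0 hXd0 hlaw' hboxC hdiscC
  -- §5 CORE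
  have hc2 : (2 * (12 * 122689728 * 2304 * (Fintype.card (Fol L) : ℝ) ^ 2 * (L : ℝ) ^ 10)) ^ 2 ≤ τ⁻¹ - 1 := by
    have h1 : 1 + 16 * (12 * 122689728 * 2304 * (Fintype.card (Fol L) : ℝ) ^ 2 * (L : ℝ) ^ 10) ^ 2 ≤ τ⁻¹ := by
      rw [le_inv_comm₀ (by positivity) hτ]; exact hτw'
    nlinarith only [h1]
  have hshell : Icc (12 * 122689728 * 2304 * (Fintype.card (Fol L) : ℝ) ^ 2 * (L : ℝ) ^ 10) (2 * (12 * 122689728 * 2304 * (Fintype.card (Fol L) : ℝ) ^ 2 * (L : ℝ) ^ 10)) ⊆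
      {δ : ℝ | τ ≤ 4 * δ ^ 2 / (1 + δ ^ 2) ^ 2 ∧ τ ≤ (1 + δ ^ 2)⁻¹} := Icc_subset_bulkWindow hτ hδr1 hc2
  have hPint : ∀ δs ∈ Icc (12 * 122689728 * 2304 * (Fintype.card (Fol L) : ℝ) ^ 2 * (L : ℝ) ^ 10) (2 * (12 * 122689728 * 2304 * (Fintype.card (Fol L) : ℝ) ^ 2 * (L : ℝ) ^ 10)),
      Integrable fun p : ℝ × ℝ => mbDensity (L := L) (hubAt δs 1) ε p :=
    fun δs hδs => integrable_mbDensity_hubAt_of_window hε hτ hτ1 (hshell hδs)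
  obtain ⟨Φc, hΦcdef⟩ : ∃ x : ℝ, x = Φ * (L : ℝ) ^ cΦ * ((Real.exp 1 * ((1 + (finrank ℝ (GnoFol L) : ℝ)) * (20400 * (L : ℝ) ^ 4)) ^ (7 / 2 : ℝ) *
      (Real.sqrt ((1 / 4 : ℝ) * (1 / (1800 * (L : ℝ) ^ 6))) ^ 3)⁻¹ * (2 * (1800 * (L : ℝ) ^ 6) ^ 2)) * (1 + S ^ 2) ^ 2) := ⟨_, rfl⟩
  have hR₀0 : 0 ≤ Real.exp 1 * ((1 + (finrank ℝ (GnoFol L) : ℝ)) * (20400 * (L : ℝ) ^ 4)) ^ (7 / 2 : ℝ) *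
      (Real.sqrt ((1 / 4 : ℝ) * (1 / (1800 * (L : ℝ) ^ 6))) ^ 3)⁻¹ * (2 * (1800 * (L : ℝ) ^ 6) ^ 2) := by
    have h1 : 0 < Real.sqrt ((1 / 4 : ℝ) * (1 / (1800 * (L : ℝ) ^ 6))) := Real.sqrt_pos.2 (by positivity)
    positivity
  have hΦc0 : 0 ≤ Φc := by rw [hΦcdef]; exact mul_nonneg (by positivity) (mul_nonneg hR₀0 (by positivity))
  have hT0 : 0 ≤ Real.exp (CT * (L : ℝ) ^ pT - b / (QT * (L : ℝ) ^ pT)) := (Real.exp_pos _).le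
  have H : ∀ δt ∈ Ioi (Real.sqrt (q - 1)), ∀ δs ∈ Icc (12 * 122689728 * 2304 * (Fintype.card (Fol L) : ℝ) ^ 2 * (L : ℝ) ^ 10)
      (2 * (12 * 122689728 * 2304 * (Fintype.card (Fol L) : ℝ) ^ 2 * (L : ℝ) ^ 10)),
      hubIntegral (L := L) (hubAt δt 1) ε b ≤
        Φc * ((2 * Real.pi / b) ^ alpha L * ∫ p : ℝ × ℝ, ((1 + δt ^ 2) ^ 2 / (1 + (p.1 ^ 2 / (1 + p.1 ^ 2) + p.2 ^ 2 / (1 + p.2 ^ 2)) * (1 + δt ^ 2))) *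
          mbDensity (L := L) (hubAt δs 1) ε p) + Real.exp (CT * (L : ℝ) ^ pT - b / (QT * (L : ℝ) ^ pT)) := by
    intro δt hδt δs hδs
    have hδt' : S ≤ δt := hSδ.trans (le_of_lt hδt)
    have hc := hcore L b hK1b ε hε S δt hDRS hδt'
    have htr := coreProfile_transfer (L := L) hε hδs hS2 (hPint δs hδs) δt
    calc hubIntegral (L := L) (hubAt δt 1) ε b
        ≤ Φ * (L : ℝ) ^ cΦ * ((2 * Real.pi / b) ^ alpha L * ∫ p : ℝ × ℝ, ((1 + δt ^ 2) ^ 2 / (1 + (p.1 ^ 2 / (1 + p.1 ^ 2) + p.2 ^ 2 / (1 + p.2 ^ 2)) * (1 + δt ^ 2))) *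
            mbDensity (L := L) (hubAt S 1) ε p) + Real.exp (CT * (L : ℝ) ^ pT - b / (QT * (L : ℝ) ^ pT)) := hc
      _ ≤ Φ * (L : ℝ) ^ cΦ * ((2 * Real.pi / b) ^ alpha L * ((Real.exp 1 * ((1 + (finrank ℝ (GnoFol L) : ℝ)) * (20400 * (L : ℝ) ^ 4)) ^ (7 / 2 : ℝ) *
            (Real.sqrt ((1 / 4 : ℝ) * (1 / (1800 * (L : ℝ) ^ 6))) ^ 3)⁻¹ * (2 * (1800 * (L : ℝ) ^ 6) ^ 2)) * (1 + S ^ 2) ^ 2 *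
            ∫ p : ℝ × ℝ, ((1 + δt ^ 2) ^ 2 / (1 + (p.1 ^ 2 / (1 + p.1 ^ 2) + p.2 ^ 2 / (1 + p.2 ^ 2)) * (1 + δt ^ 2))) * mbDensity (L := L) (hubAt δs 1) ε p)) +
            Real.exp (CT * (L : ℝ) ^ pT - b / (QT * (L : ℝ) ^ pT)) :=
          add_le_add (mul_le_mul_of_nonneg_left (mul_le_mul_of_nonneg_left htr hG0) (by positivity)) le_rfl
      _ = _ := by rw [hΦcdef]; ring
  have hcoreC := (tipCore_le_mbMain_of_profile (L := L) hε hτ hτw' hρ4 hρ41 le_rfl hδb1 hΦc0 hT0 hb0.le H).trans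
    (tipCore_coef_le (L := L) hΦc0 hG0 hM0 hT0 hδb1)
  obtain ⟨cC, hcC⟩ : ∃ x : ℝ, x = ((96 / 7) * (12 * 122689728 * 2304 * 36) ^ 3 *
      (32 * (12 * 44712000 * 2304 * 36) ^ 2 + 1024 * (3 * (19 * 20400) ^ 4 * 7200 ^ 2 * (2 * 1800 ^ 2)) * (25 * (12 * 122689728 * 2304 * 36) ^ 4) * 4 *
        (8 * (12 * 44712000 * 2304 * 36) ^ 2) * (2 * (4 / 3)))) * (L : ℝ) ^ 218 := ⟨_, rfl⟩
  rw [← hcC] at hcoreC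
  -- §6 the two rates
  have hmainC : stiffKappa L (1 / 8) * (2 * (cB + cD)) ≤
      9 * 2 * ((3 * (19 * 20400) ^ 4 * 7200 ^ 2 * (2 * 1800 ^ 2) * (16 * (12 * 44712000 * 2304 * 36) ^ 2 * 2) * Real.sqrt 2 *
          ((96 / 7) * (12 * 122689728 * 2304 * 36) ^ 3)) +
        (256 * 2 * 16 * (4 / 3) * 25 * 4 * 2 * (20 / 3) * 2 * (12 * 122689728 * 2304 * 36) * (3 * (19 * 20400) ^ 4 * 7200 ^ 2 * (2 * 1800 ^ 2)) ^ 2 *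
          (12 * 122689728 * 2304 * 36) ^ 4 * (12 * 44712000 * 2304 * 36) ^ 2 * (12 * 122689728 * 2304 * 36) ^ 2)) * (L : ℝ) ^ 278 * τ ^ (3 / 8 : ℝ) := by
    have hL146 : (L : ℝ) ^ 146 ≤ (L : ℝ) ^ 274 := pow_le_pow_right₀ hL1 (by norm_num)
    have h1 : cB ≤ (3 * (19 * 20400) ^ 4 * 7200 ^ 2 * (2 * 1800 ^ 2) * (16 * (12 * 44712000 * 2304 * 36) ^ 2 * 2) * Real.sqrt 2 *
          ((96 / 7) * (12 * 122689728 * 2304 * 36) ^ 3)) * (L : ℝ) ^ 274 * τ ^ (3 / 8 : ℝ) := by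
      rw [hcB]; exact mul_le_mul_of_nonneg_right (mul_le_mul_of_nonneg_left hL146 (by positivity)) hτ38
    have h2 : 2 * (cB + cD) ≤ (2 * ((3 * (19 * 20400) ^ 4 * 7200 ^ 2 * (2 * 1800 ^ 2) * (16 * (12 * 44712000 * 2304 * 36) ^ 2 * 2) * Real.sqrt 2 *
          ((96 / 7) * (12 * 122689728 * 2304 * 36) ^ 3)) +
        (256 * 2 * 16 * (4 / 3) * 25 * 4 * 2 * (20 / 3) * 2 * (12 * 122689728 * 2304 * 36) * (3 * (19 * 20400) ^ 4 * 7200 ^ 2 * (2 * 1800 ^ 2)) ^ 2 *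
          (12 * 122689728 * 2304 * 36) ^ 4 * (12 * 44712000 * 2304 * 36) ^ 2 * (12 * 122689728 * 2304 * 36) ^ 2))) * ((L : ℝ) ^ 274 * τ ^ (3 / 8 : ℝ)) := by
      rw [hcD]; linarith only [h1]
    have h0 : 0 ≤ 2 * (cB + cD) := by rw [hcB, hcD]; positivity
    calc stiffKappa L (1 / 8) * (2 * (cB + cD)) ≤ (9 * (L : ℝ) ^ 4) * ((2 * ((3 * (19 * 20400) ^ 4 * 7200 ^ 2 * (2 * 1800 ^ 2) * (16 * (12 * 44712000 * 2304 * 36) ^ 2 * 2) * Real.sqrt 2 *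
          ((96 / 7) * (12 * 122689728 * 2304 * 36) ^ 3)) +
        (256 * 2 * 16 * (4 / 3) * 25 * 4 * 2 * (20 / 3) * 2 * (12 * 122689728 * 2304 * 36) * (3 * (19 * 20400) ^ 4 * 7200 ^ 2 * (2 * 1800 ^ 2)) ^ 2 *
          (12 * 122689728 * 2304 * 36) ^ 4 * (12 * 44712000 * 2304 * 36) ^ 2 * (12 * 122689728 * 2304 * 36) ^ 2))) * ((L : ℝ) ^ 274 * τ ^ (3 / 8 : ℝ))) :=
          mul_le_mul hκ.2 h2 h0 (by positivity)
      _ = _ := by ring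
  have hmainD : stiffKappa L (1 / 8) * (Φc * cC * Real.sqrt (q - 1) ^ (-(3 / 4 : ℝ))) ≤
      9 * (Φ * ((3 * (19 * 20400) ^ 4 * 7200 ^ 2 * (2 * 1800 ^ 2)) * (4 * (DR + 2 * (12 * 122689728 * 2304 * 36)) ^ 4)) *
        ((96 / 7) * (12 * 122689728 * 2304 * 36) ^ 3 *
          (32 * (12 * 44712000 * 2304 * 36) ^ 2 + 1024 * (3 * (19 * 20400) ^ 4 * 7200 ^ 2 * (2 * 1800 ^ 2)) * (25 * (12 * 122689728 * 2304 * 36) ^ 4) * 4 *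
            (8 * (12 * 44712000 * 2304 * 36) ^ 2) * (2 * (4 / 3)))) * 2) *
        (L : ℝ) ^ (4 + (cΦ + (56 + 4 * (dR + 18))) + 218) * b ^ (-(3 / (8 * ((2 * (k + 1) : ℕ) : ℝ)))) := by
    have hrate : Real.sqrt (q - 1) ^ (-(3 / 4 : ℝ)) ≤ 2 * b ^ (-(3 / (8 * ((2 * (k + 1) : ℕ) : ℝ)))) := by rw [← hqη]; exact hδb34
    have hSS : (1 + S ^ 2) ^ 2 ≤ 4 * (DR + 2 * (12 * 122689728 * 2304 * 36)) ^ 4 * (L : ℝ) ^ (4 * (dR + 18)) := by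
      have h1 : 1 + S ^ 2 ≤ 2 * S ^ 2 := by nlinarith only [hS1]
      have h2 : (1 + S ^ 2) ^ 2 ≤ (2 * S ^ 2) ^ 2 := pow_le_pow_left₀ (by positivity) h1 2
      have h3 : (2 * S ^ 2) ^ 2 = 4 * (DR + 2 * (12 * 122689728 * 2304 * 36)) ^ 4 * (L : ℝ) ^ (4 * (dR + 18)) := by rw [hSdef]; ring
      rw [← h3]; exact h2
    have hΦcle : Φc ≤ Φ * (L : ℝ) ^ cΦ * ((3 * (19 * 20400) ^ 4 * 7200 ^ 2 * (2 * 1800 ^ 2) * (L : ℝ) ^ 56) * (4 * (DR + 2 * (12 * 122689728 * 2304 * 36)) ^ 4 * (L : ℝ) ^ (4 * (dR + 18)))) := by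
      rw [hΦcdef]
      exact mul_le_mul_of_nonneg_left (mul_le_mul hR0 hSS (by positivity) (by positivity)) (by positivity)
    have hcC0 : 0 ≤ cC := by rw [hcC]; positivity
    have hr0 : 0 ≤ Real.sqrt (q - 1) ^ (-(3 / 4 : ℝ)) := Real.rpow_nonneg (by linarith only [hδb1]) _
    have h1 : Φc * cC * Real.sqrt (q - 1) ^ (-(3 / 4 : ℝ)) ≤
        (Φ * (L : ℝ) ^ cΦ * ((3 * (19 * 20400) ^ 4 * 7200 ^ 2 * (2 * 1800 ^ 2) * (L : ℝ) ^ 56) * (4 * (DR + 2 * (12 * 122689728 * 2304 * 36)) ^ 4 * (L : ℝ) ^ (4 * (dR + 18))))) * cC *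
          (2 * b ^ (-(3 / (8 * ((2 * (k + 1) : ℕ) : ℝ))))) :=
      mul_le_mul (mul_le_mul_of_nonneg_right hΦcle hcC0) hrate hr0 (by positivity)
    have h0 : 0 ≤ Φc * cC * Real.sqrt (q - 1) ^ (-(3 / 4 : ℝ)) := by positivity
    calc stiffKappa L (1 / 8) * (Φc * cC * Real.sqrt (q - 1) ^ (-(3 / 4 : ℝ)))
        ≤ (9 * (L : ℝ) ^ 4) * ((Φ * (L : ℝ) ^ cΦ * ((3 * (19 * 20400) ^ 4 * 7200 ^ 2 * (2 * 1800 ^ 2) * (L : ℝ) ^ 56) * (4 * (DR + 2 * (12 * 122689728 * 2304 * 36)) ^ 4 * (L : ℝ) ^ (4 * (dR + 18))))) * cC *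
          (2 * b ^ (-(3 / (8 * ((2 * (k + 1) : ℕ) : ℝ)))))) := mul_le_mul hκ.2 h1 h0 (by positivity)
      _ = _ := by rw [hcC]; ring
  -- §7 the tails
  have hsqrtb : Real.sqrt b ≤ b := by
    have h1 : 1 ≤ Real.sqrt b := Real.one_le_sqrt.2 hb1
    nlinarith only [Real.sq_sqrt hb0.le, h1, Real.sqrt_nonneg b]
  have hpTP : pT ≤ k * k + pT + 4 := (Nat.le_add_left _ _).trans (Nat.le_add_right _ _)
  have hx1 : Real.sqrt b / ((K ^ k + QT) * (L : ℝ) ^ (k * k + pT + 4)) ≤ b * (q⁻¹ / (K * (L : ℝ) ^ k)) ^ k := by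
    have e1 : (K * (L : ℝ) ^ k) ^ k = K ^ k * (L : ℝ) ^ (k * k) := by rw [mul_pow, ← pow_mul]
    have hlt := lawTail_exponent k (X := K * (L : ℝ) ^ k) (by positivity) hq1
    rw [hqn] at hlt
    have hden : K ^ k * (L : ℝ) ^ (k * k) ≤ (K ^ k + QT) * (L : ℝ) ^ (k * k + pT + 4) :=
      mul_le_mul (le_add_of_nonneg_right hQT.le) (pow_le_pow_right₀ hL1 ((Nat.le_add_right _ _).trans (Nat.le_add_right _ _))) (by positivity) (by positivity)
    calc Real.sqrt b / ((K ^ k + QT) * (L : ℝ) ^ (k * k + pT + 4)) = q ^ (k + 1) / ((K ^ k + QT) * (L : ℝ) ^ (k * k + pT + 4)) := by rw [hsqrt]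
      _ ≤ q ^ (k + 1) / (K ^ k * (L : ℝ) ^ (k * k)) := div_le_div_of_nonneg_left (by positivity) (by positivity) hden
      _ = q ^ (k + 1) / (K * (L : ℝ) ^ k) ^ k := by rw [e1]
      _ ≤ b * (q⁻¹ / (K * (L : ℝ) ^ k)) ^ k := hlt
  have hx2 : Real.sqrt b / ((K ^ k + QT) * (L : ℝ) ^ (k * k + pT + 4)) ≤ b / (QT * (L : ℝ) ^ pT) :=
    div_le_div₀ hb0.le hsqrtb (by positivity)
      (mul_le_mul (by linarith only [pow_nonneg hK.le k]) (pow_le_pow_right₀ hL1 hpTP) (by positivity) (by positivity))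
  have htail := tipTails_le (CT := CT) hL1 hκ.1.le hκ.2 hMass0 (totalMass_le_exp (L := L)) (abs_nonneg _) hx1 hx2 hcc hpTP
    ((Nat.le_add_left _ _))
  -- §8 assemble
  rw [hsplit, mul_add]
  have htot := add_le_add hmid ((mul_le_mul_of_nonneg_left hcore_mono hcc.le).trans hcoreC)
  rw [pow_zero, pow_zero, mul_one, mul_one]
  calc stiffKappa L (1 / 8) * (coneConst * Real.pi * (∫ δ in Mid, ((1 + δ ^ 2)⁻¹) ^ 2 * hubIntegral (L := L) (hubAt δ 1) ε b) +
        coneConst * Real.pi * ∫ δ in Core, ((1 + δ ^ 2)⁻¹) ^ 2 * hubIntegral (L := L) (hubAt δ 1) ε b)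
      ≤ stiffKappa L (1 / 8) * ((2 * (cB + cD) * ((2 * Real.pi / b) ^ alpha L * ∫ a in HubBulk τ, (∫ p : ℝ × ℝ, mbDensity (L := L) a ε p) ∂coneMeasure) +
            (∫ η : GnoCoord L, gnoDensity η) * (coneConst * Real.pi) * Real.exp (-(b * (q⁻¹ / (K * (L : ℝ) ^ k)) ^ k))) +
          (Φc * cC * Real.sqrt (q - 1) ^ (-(3 / 4 : ℝ)) * ((2 * Real.pi / b) ^ alpha L * ∫ a in HubBulk τ, (∫ p : ℝ × ℝ, mbDensity (L := L) a ε p) ∂coneMeasure) +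
            coneConst * Real.pi * Real.exp (CT * (L : ℝ) ^ pT - b / (QT * (L : ℝ) ^ pT)))) := mul_le_mul_of_nonneg_left htot hκ.1.le
    _ = (stiffKappa L (1 / 8) * (2 * (cB + cD)) + stiffKappa L (1 / 8) * (Φc * cC * Real.sqrt (q - 1) ^ (-(3 / 4 : ℝ)))) *
          ((2 * Real.pi / b) ^ alpha L * ∫ a in HubBulk τ, (∫ p : ℝ × ℝ, mbDensity (L := L) a ε p) ∂coneMeasure) +
        stiffKappa L (1 / 8) * ((∫ η : GnoCoord L, gnoDensity η) * (coneConst * Real.pi) * Real.exp (-(b * (q⁻¹ / (K * (L : ℝ) ^ k)) ^ k)) +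
          coneConst * Real.pi * Real.exp (CT * (L : ℝ) ^ pT - b / (QT * (L : ℝ) ^ pT))) := by ring
    _ ≤ _ := add_le_add (mul_le_mul_of_nonneg_right (add_le_add hmainC hmainD) (mul_nonneg hG0 hM0)) htail

/-- ★★★ **`stub_core_tip` OF SKELETON ➎ FROM THE (hCore) SOCKET**: the conclusion is `stub_core_tip` VERBATIM (✓`stub_core_tip_of_pos` ∘ `halfBound_pos_of_core`). [cite: Luscher1983, §2] -/
theorem stub_core_tip_of_core
    (hCore : ∃ Φ : ℝ, 0 < Φ ∧ ∃ cΦ : ℕ, ∃ CT : ℝ, ∃ pT : ℕ, ∃ QT : ℝ, 0 < QT ∧ ∃ K₁ : ℝ, 0 < K₁ ∧ ∃ k₁ : ℕ, ∃ DR : ℝ, 1 ≤ DR ∧ ∃ dR : ℕ,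
      ∀ (L : ℕ) [NeZero L] (b : ℝ), K₁ * (L : ℝ) ^ k₁ ≤ b → ∀ ε : GnoSign L, GoodSign ε → ∀ δs δt : ℝ, DR * (L : ℝ) ^ dR ≤ δs → δs ≤ δt →
        hubIntegral (L := L) (hubAt δt 1) ε b ≤
          Φ * (L : ℝ) ^ cΦ * ((2 * Real.pi / b) ^ alpha L * ∫ p : ℝ × ℝ, ((1 + δt ^ 2) ^ 2 / (1 + (p.1 ^ 2 / (1 + p.1 ^ 2) + p.2 ^ 2 / (1 + p.2 ^ 2)) * (1 + δt ^ 2))) *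
            mbDensity (L := L) (hubAt δs 1) ε p) + Real.exp (CT * (L : ℝ) ^ pT - b / (QT * (L : ℝ) ^ pT))) :
    ∃ K : ℝ, 0 < K ∧ ∃ k : ℕ, ∃ τ₀ : ℝ, 0 < τ₀ ∧ τ₀ ≤ 1 / 2 ∧ ∀ (L : ℕ) [NeZero L] (τ : ℝ), 0 < τ → τ ≤ τ₀ / (L : ℝ) ^ k →
      ∀ b : ℝ, K * (L : ℝ) ^ k * τ⁻¹ ^ k ≤ b →
        stiffKappa L (1 / 8) * ∑ ε ∈ (Finset.univ.filter fun ε : GnoSign L => GoodSign ε),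
            ∫ x in TipHub τ ×ˢ (univ : Set (GnoCoord L)), Real.exp (-(b * gnoDeficit z₀ (fun _ => 1) x.1 ε x.2)) ∂chartMeasure L ≤
          (1 / 32 : ℝ) * ∑ ε ∈ (Finset.univ.filter fun ε : GnoSign L => GoodSign ε), ∫ a in HubBulk τ, hubIntegral a ε b ∂coneMeasure :=
  stub_core_tip_of_pos (halfBound_pos_of_core hCore)

end Summit.QuantumFields.YangMills.Theorems.SwapVirialDeficit.SectorLaplace

end
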